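import Mathlib.Analysis.InnerProductSpace.Calculus
import Mathlib.Analysis.InnerProductSpace.Projection.FiniteDimensional
import Literature.Topology.FourManifolds.ProjectiveTowerConcordance
import Literature.Topology.FourManifolds.ProjectiveTowersProofs
import Literature.Topology.FourManifolds.InverseFunctionTheorem
import Literature.Topology.FourManifolds.SmoothEmbeddingCriteria
import Literature.Topology.FourManifolds.FramedStandardSpheres
import Literature.Topology.FourManifolds.SliceRibbonConcordanceProofs
import Literature.Topology.FourManifolds.ConcordanceTransitivity
import Literature.Topology.FourManifolds.RasmussenProofs
import HarnessLib

/-!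
# Puncturing an H-slice disc: MMSW Cor. 1.9 (knots) from the relative inequality Thm. 1.8 / 6.11 (cylinder case)

Sibling proof file of `ProjectiveTowerConcordance.lean` and second sibling of `ProjectiveTowers.lean` for the named fact
`Literature.Topology.FourManifolds.Knot.rasmussen_nonpos_of_isTowerSlice` (MMSW 2023, Cor. 1.9 = Cor. 6.12, knot-and-disc
case).  Everything here is **proved**; no named fact is introduced (D-0026).

Manolescu–Marengon–Sarkar–Willis obtain Cor. 6.12 from the relative Thm. 6.11 *"by further specializing to the case
`L₁ = ∅` (for which `s = 1`)"*.  The tree cannot speak of the empty link, but it can PUNCTURE: given an H-slice disc `D`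
for `K` in an `o`-tower `P` (`Knot.IsTowerSlice o K`), a small ball `B_in ⊂ P` adapted to `D` at an interior point cuts
`D` into a small flat disc and a null-homologous ANNULUS in the twice-punctured tower `P ∖ (B̊_in ⊔ B̊_out)` running from
the round UNKNOT `U ⊂ ∂B_in` to `K ⊂ ∂B_out` (`Knot.IsTowerSlice.isTowerConcordant_unknot`, proved here).  Thm. 6.11 for
this cylinder reads `s(K) ≤ s(U) = 0` — Cor. 1.9 for knots.  The same puncturing (of `B⁴` itself) is MMSW's proof of
Thm. 6.14 and of Prop. 7.6 (v).

## What is proved here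

* Linear algebra and an **adapted ball chart**: `Knot.Puncture.exists_clEquiv_comp_inclusion` (an injective linear
  `ℝ² → ℝ⁴` extends to an automorphism of `ℝ⁴` along the coordinate inclusion `ι : ℝ² → ℝ⁴`),
  `Knot.Puncture.exists_adaptedChart` (for a smooth `f : ℝ² → P` immersive at `0` there is a partial diffeomorphism
  `Θ : ℝ⁴ ⇀ P` at `0` with `Θ ∘ ι = f` near `0` — inverse function theorem on manifolds,
  `isLocalDiffeomorphAt_of_hasFDerivAt_writtenInExtChartAt`, applied to `w ↦ φ⁻¹ (φ (f (π w)) + A (w − ι (π w)))`).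
* `Knot.IsTowerSlice.isTowerConcordant_unknot` — **puncturing**: `K.IsTowerSlice o → IsTowerConcordant (-o) unknot K`.
  The inner ball is `e₁ = Θ ∘ univBall 0 δ` (a smooth embedding of `ℝ⁴`, `isSmoothEmbedding_of_openPartialHomeomorph`),
  which satisfies `e₁ ∘ ι = f ∘ univBall 0 δ` and hence bounds, along the UNKNOT `(x₀, x₁) ↦ (x₀, x₁, 0, 0)`, the annulus
  `(x, t) ↦ f (r(t) • x)` (`r` affine, `r(1) = δ/√2`, `r(2) = 1`) cut out of the disc; `δ` is taken so small that the
  ball misses `e(𝔻⁴)`, lies in the `H₂ = 0` neighbourhood `U`, and meets the disc only in its central part.  The outer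
  ball is the original chart `e`, which is orientation preserving towards `oP`, i.e. REVERSING towards `-oP`; the inner
  ball is made orientation PRESERVING towards `-oP` by precomposing, if necessary, with the reflection
  `ρ = reflectLastCLM 3` of `ℝ⁴`, which fixes `ι(ℝ²)` and the unknot pointwise (a disc preserves or reverses orientation,
  `isOrientationPreserving_or_isOrientationReversing_disc`; `det ρ = -1`).  So the datum lives in the `(-o)`-tower
  `(P, -oP)` (`IsProjectiveTower.neg`).
* `Knot.rasmussen_nonpos_of_isTowerSlice_of_rasmussenAntitoneOver` — **Cor. 1.9 (knots) from Thm. 6.11 (cylinders)**: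
  `RasmussenAntitoneOver o → ∀ K, K.IsTowerSlice (-o) → ∀ s, K.HasRasmussenInvariant s → s ≤ 0` (`s(unknot) = 0`,
  `hasRasmussenInvariant_unknot_holds`), and the packaged form
  `Knot.rasmussen_nonpos_of_isTowerSlice_of_exists_rasmussenAntitoneOver :
    (∃ o, RasmussenAntitoneOver o) → Knot.rasmussen_nonpos_of_isTowerSlice`.
* Height `0`: `Knot.IsConcordance.isConcordanceIn_sphere` (a concordance in the shell `1 ≤ ‖y‖ ≤ 2` of `ℝ⁴` is a
  concordance datum in `S⁴` between the round unit-ball chart `c⁻¹` and the OUTER ball `outerBall a : z ↦ -c⁻¹(-2z)`, the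
  ball chart at the antipode, which off the origin is `c⁻¹ ∘ (z ↦ 2z/‖z‖²)`), `Knot.isOrientationReversing_outerBall`
  (the outer ball has the orientation character OPPOSITE to `c⁻¹`: the inversion `z ↦ 2z/‖z‖²` has differential `2ρ`
  at the last basis vector, `ρ` the reflection in the last coordinate, of determinant `2⁴ · (-1) < 0` — the tree form of
  "the two ends of `I × S³ ≅ S⁴ ∖ (B̊ ⊔ B̊)` are spheres bounding balls of opposite orientation character"),
  `Knot.IsConcordant.isTowerConcordant` (so concordant knots are tower-concordant at height `0` over every `o`, with
  `U = S⁴`, `H₂(S⁴; ℤ) = 0`) and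
  `HasRasmussenInvariant.eq_of_isConcordant_of_rasmussenAntitoneOver :
    RasmussenAntitoneOver o → HasRasmussenInvariant.eq_of_isConcordant` — at height `0` the relative inequality is
  concordance invariance of `s` (Rasmussen 2010, Thm. 1; the named fact of `Rasmussen.lean`), using symmetry of
  concordance (`IsConcordant.swap`) for the reverse inequality.

## References

* C. Manolescu, M. Marengon, S. Sarkar, M. Willis, *A generalization of Rasmussen's invariant, with applications to
  surfaces in some four-manifolds*, Duke Math. J. 172 (2023) 231–311 (arXiv:1910.08195): Thm. 1.8 = Thm. 6.11, Cor. 1.9 =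
  Cor. 6.12, Remark 6.1, Thm. 6.14, Prop. 7.6 (v), Thm. 7.9–7.10 [ManolescuMarengonSarkarWillis2023].
* J. Rasmussen, *Khovanov homology and the slice genus*, Invent. Math. 182 (2010), Thm. 1 [Rasmussen2010].
* J. M. Lee, *Introduction to Smooth Manifolds*, 2nd ed. (2013), Thm. 4.5, Prop. 5.2 [LeeSmoothManifolds2013].
* M. W. Hirsch, *Differential Topology* (1976), §4.4 [HirschDT1976].
-/

noncomputable section

open scoped Manifold ContDiff Topology
open Set Function Filter CategoryTheory.Limits
open Literature.AlgebraicTopology.SingularHomology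

namespace Literature.Topology.FourManifolds

attribute [local instance] fact_finrank_euclideanSpace_two fact_finrank_euclideanSpace_four

/-- Local notation: the model space `ℝⁿ`. -/
local notation "𝔼 " n:arg => EuclideanSpace ℝ (Fin n)
/-- Local notation: `𝕊 n` is the unit sphere in `ℝⁿ⁺¹`. -/
local notation "𝕊 " n:arg => (Metric.sphere (0 : EuclideanSpace ℝ (Fin (n + 1))) 1)

namespace Knot

namespace Puncture

/-! ### Coordinates: `ℝ⁴ = ι(ℝ²) ⊕ κ(ℝ²)` -/

/-- The coordinate inclusion `ι : ℝ² → ℝ⁴`, `(u₀, u₁) ↦ (u₀, u₁, 0, 0)` (the tree's `euclideanInclusionCLM 2 4`; on the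
unit circle it is the round unknot `unknot`). [folklore] -/
abbrev ι : 𝔼 2 →L[ℝ] 𝔼 4 := euclideanInclusionCLM 2 4

/-- The projection `π : ℝ⁴ → ℝ²` onto the first two coordinates, `w ↦ (w₀, w₁)`. [folklore] -/
def π : 𝔼 4 →L[ℝ] 𝔼 2 where
  toFun w := WithLp.toLp 2 fun i : Fin 2 => w (Fin.castLE (by norm_num) i)
  map_add' w w' := by ext i; simp
  map_smul' c w := by ext i; simp
  cont := (PiLp.continuous_toLp 2 _).comp
    (continuous_pi fun i => (PiLp.continuous_apply 2 _ _).comp continuous_id)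

/-- The projection `π' : ℝ⁴ → ℝ²` onto the last two coordinates, `w ↦ (w₂, w₃)`. [folklore] -/
def π' : 𝔼 4 →L[ℝ] 𝔼 2 where
  toFun w := WithLp.toLp 2 fun i : Fin 2 => w (Fin.natAdd 2 i)
  map_add' w w' := by ext i; simp
  map_smul' c w := by ext i; simp
  cont := (PiLp.continuous_toLp 2 _).comp
    (continuous_pi fun i => (PiLp.continuous_apply 2 _ _).comp continuous_id)

/-- Coordinates of `π w`. [folklore] -/
@[simp] theorem π_apply (w : 𝔼 4) (i : Fin 2) : π w i = w (Fin.castLE (by norm_num) i) := rfl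

/-- Coordinates of `π' w`. [folklore] -/
@[simp] theorem π'_apply (w : 𝔼 4) (i : Fin 2) : π' w i = w (Fin.natAdd 2 i) := rfl

/-- `π (ι u) = u`. [folklore] -/
@[simp] theorem π_ι (u : 𝔼 2) : π (ι u) = u := by
  ext i
  have hi : ((Fin.castLE (by norm_num : 2 ≤ 4) i : Fin 4) : ℕ) < 2 := by simp [i.2]
  rw [π_apply, euclideanInclusionCLM_apply, euclideanInclusion_apply, dif_pos hi]
  exact congrArg u (Fin.ext rfl)

/-- `π' (ι u) = 0`. [folklore] -/
@[simp] theorem π'_ι (u : 𝔼 2) : π' (ι u) = 0 := by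
  ext i
  have hi : ¬ ((Fin.natAdd 2 i : Fin 4) : ℕ) < 2 := by simp
  rw [π'_apply, euclideanInclusionCLM_apply, euclideanInclusion_apply, dif_neg hi]
  rfl

/-- A vector of `ℝ⁴` with `π w = 0` and `π' w = 0` is zero. [folklore] -/
theorem eq_zero_of_π_eq_zero_of_π'_eq_zero {w : 𝔼 4} (h : π w = 0) (h' : π' w = 0) : w = 0 := by
  ext i
  have h0 : ∀ j : Fin 2, w (Fin.castLE (by norm_num) j) = 0 := fun j => by
    simpa using congrArg (fun v : 𝔼 2 => v j) h
  have h1 : ∀ j : Fin 2, w (Fin.natAdd 2 j) = 0 := fun j => by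
    simpa using congrArg (fun v : 𝔼 2 => v j) h'
  by_cases hi : (i : ℕ) < 2
  · have := h0 ⟨i, hi⟩
    simpa using this
  · obtain ⟨j, hj⟩ : ∃ j : Fin 2, Fin.natAdd 2 j = i :=
      ⟨⟨i - 2, by omega⟩, Fin.ext (by simp; omega)⟩
    rw [← hj]
    simpa using h1 j

/-- `‖ι u‖ = ‖u‖`. [folklore] -/
@[simp] theorem norm_ι (u : 𝔼 2) : ‖ι u‖ = ‖u‖ :=
  norm_euclideanInclusion (by norm_num) u

/-- The reflection `ρ = reflectLastCLM 3` of `ℝ⁴` in its last coordinate fixes `ι(ℝ²)` pointwise. [folklore] -/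
@[simp] theorem reflectLastCLM_ι (u : 𝔼 2) : reflectLastCLM 3 (ι u) = ι u := by
  ext i
  change (if i = Fin.last 3 then -(ι u) i else (ι u) i) = ι u i
  split_ifs with hi
  · subst hi
    have h3 : ¬ ((Fin.last 3 : Fin 4) : ℕ) < 2 := by simp
    rw [euclideanInclusionCLM_apply, euclideanInclusion_apply, dif_neg h3, neg_zero]
  · rfl

/-! ### Extending an injective linear map `ℝ² → ℝ⁴` to an automorphism of `ℝ⁴` -/

/-- **An injective linear map `T : ℝ² → ℝ⁴` extends along `ι` to a linear automorphism `A` of `ℝ⁴`** (`A ∘ ι = T`):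
`A w = T (π w) + χ (π' w)` with `χ : ℝ² ≅ (range T)ᗮ`, injective because `range T ∩ (range T)ᗮ = 0`. [folklore] -/
theorem exists_clEquiv_comp_inclusion (T : 𝔼 2 →L[ℝ] 𝔼 4) (hT : Function.Injective T) :
    ∃ A : 𝔼 4 ≃L[ℝ] 𝔼 4, ∀ u, A (ι u) = T u := by
  set R : Submodule ℝ (𝔼 4) := LinearMap.range (T : 𝔼 2 →ₗ[ℝ] 𝔼 4) with hR
  have hRrank : Module.finrank ℝ R = 2 := by
    rw [hR, LinearMap.finrank_range_of_inj hT, finrank_euclideanSpace_fin]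
  have hWrank : Module.finrank ℝ Rᗮ = 2 := by
    have h := Submodule.finrank_add_finrank_orthogonal R
    rw [finrank_euclideanSpace_fin, hRrank] at h
    omega
  obtain ⟨χ⟩ : Nonempty ((𝔼 2) ≃ₗ[ℝ] Rᗮ) :=
    ⟨LinearEquiv.ofFinrankEq _ _ (by rw [hWrank, finrank_euclideanSpace_fin])⟩
  set A₀ : 𝔼 4 →ₗ[ℝ] 𝔼 4 :=
    (T : 𝔼 2 →ₗ[ℝ] 𝔼 4) ∘ₗ (π : 𝔼 4 →ₗ[ℝ] 𝔼 2) + Rᗮ.subtype ∘ₗ χ.toLinearMap ∘ₗ (π' : 𝔼 4 →ₗ[ℝ] 𝔼 2)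
    with hA₀
  have hA₀_apply : ∀ w, A₀ w = T (π w) + (χ (π' w) : 𝔼 4) := fun w => rfl
  have hinj : Function.Injective A₀ := by
    rw [injective_iff_map_eq_zero]
    intro w hw
    rw [hA₀_apply] at hw
    have h1 : T (π w) ∈ R := LinearMap.mem_range_self _ _
    have h2 : T (π w) ∈ Rᗮ := by
      have : T (π w) = -(χ (π' w) : 𝔼 4) := eq_neg_of_add_eq_zero_left hw
      rw [this]
      exact Rᗮ.neg_mem (χ (π' w)).2
    have h3 : T (π w) = 0 := by
      have : T (π w) ∈ R ⊓ Rᗮ := ⟨h1, h2⟩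
      rwa [Submodule.inf_orthogonal_eq_bot, Submodule.mem_bot] at this
    have hπ : π w = 0 := hT (by rw [h3, map_zero])
    have hχ : (χ (π' w) : 𝔼 4) = 0 := by rwa [h3, zero_add] at hw
    have hπ' : π' w = 0 := by
      have : χ (π' w) = 0 := Subtype.ext hχ
      simpa using this
    exact eq_zero_of_π_eq_zero_of_π'_eq_zero hπ hπ'
  refine ⟨(LinearEquiv.ofInjectiveEndo A₀ hinj).toContinuousLinearEquiv, fun u => ?_⟩
  change A₀ (ι u) = T u
  rw [hA₀_apply, π_ι, π'_ι, map_zero]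
  simp

/-! ### An adapted ball chart at an interior point of an immersed disc -/

variable {P : Type*} [TopologicalSpace P] [ChartedSpace (𝔼 4) P] [IsManifold (𝓡 4) ∞ P]

/-- **Adapted chart (inverse function theorem).** Let `f : ℝ² → P` be a smooth map into a 4-manifold whose differential
at `0` is injective.  Then there is a partial diffeomorphism `Θ : ℝ⁴ ⇀ P` (an open partial homeomorphism, `C^∞` with `C^∞`
inverse) defined at `0` which restricts to `f` on the coordinate plane `ι(ℝ²)` near `0`: `Θ (ι u) = f u` for `u` near `0`.
Construction: in the chart `φ` at `f 0` put `g = φ ∘ f`, extend `dg₀` along `ι` to an automorphism `A` of `ℝ⁴`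
(`exists_clEquiv_comp_inclusion`) and set `Θ = φ⁻¹ ∘ Ψ`, `Ψ w = g (π w) + A (w − ι (π w))`; then `dΨ₀ = A` is invertible
and the inverse function theorem on manifolds (`isLocalDiffeomorphAt_of_hasFDerivAt_writtenInExtChartAt`) applies.
(Lee 2013, Thm. 4.5 and the local slice/immersion theorem, Thm. 4.12.) [cite: LeeSmoothManifolds2013, Thm. 4.5 and Thm. 4.12] -/
theorem exists_adaptedChart {f : 𝔼 2 → P} (hf : ContMDiff (𝓡 2) (𝓡 4) ∞ f)
    (h0 : Function.Injective (mfderiv (𝓡 2) (𝓡 4) f 0)) :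
    ∃ Θ : OpenPartialHomeomorph (𝔼 4) P, 0 ∈ Θ.source ∧
      ContMDiffOn 𝓘(ℝ, 𝔼 4) (𝓡 4) ∞ Θ Θ.source ∧ ContMDiffOn (𝓡 4) 𝓘(ℝ, 𝔼 4) ∞ Θ.symm Θ.target ∧
      ∀ᶠ u in 𝓝 (0 : 𝔼 2), ι u ∈ Θ.source ∧ Θ (ι u) = f u := by
  have hn0 : (∞ : ℕ∞ω) ≠ 0 := by simp
  -- the chart at `f 0` and the chart representative `g` of `f`
  set φ := extChartAt (𝓡 4) (f 0) with hφ
  set g : 𝔼 2 → 𝔼 4 := writtenInExtChartAt (𝓡 2) (𝓡 4) 0 f with hg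
  have hg_apply : ∀ u, g u = φ (f u) := fun u => rfl
  -- `dg₀ = mfderiv f 0`, injective
  set T : 𝔼 2 →L[ℝ] 𝔼 4 := mfderiv (𝓡 2) (𝓡 4) f 0 with hT
  have hmd : MDifferentiableAt (𝓡 2) (𝓡 4) f 0 := (hf 0).mdifferentiableAt hn0
  have hgT : HasFDerivAt g T 0 := by
    have hd : DifferentiableWithinAt ℝ g (range (𝓡 2)) (extChartAt (𝓡 2) (0 : 𝔼 2) 0) :=
      hmd.differentiableWithinAt_writtenInExtChartAt
    rw [ModelWithCorners.range_eq_univ, differentiableWithinAt_univ] at hd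
    have h := hd.hasFDerivAt
    rw [← fderivWithin_univ, ← (𝓡 2).range_eq_univ, ← hmd.mfderiv] at h
    exact h
  -- extend `T` along `ι` to an automorphism `A` of `ℝ⁴`
  obtain ⟨A, hA⟩ := exists_clEquiv_comp_inclusion T h0
  -- `Ψ w = g (π w) + A (w - ι (π w))` and `Θ₀ = φ⁻¹ ∘ Ψ`
  set Ψ : 𝔼 4 → 𝔼 4 := fun w => g (π w) + A (w - ι (π w)) with hΨ
  set Θ₀ : 𝔼 4 → P := fun w => φ.symm (Ψ w) with hΘ₀
  -- the open set `V` where `f ∘ π` stays in the chart domain; `Ψ` is smooth there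
  set V : Set (𝔼 4) := (fun w => f (π w)) ⁻¹' (chartAt (𝔼 4) (f 0)).source with hV
  have hVopen : IsOpen V :=
    (chartAt (𝔼 4) (f 0)).open_source.preimage (hf.continuous.comp π.continuous)
  have h0V : (0 : 𝔼 4) ∈ V := by
    simp only [hV, mem_preimage, map_zero]
    exact mem_chart_source _ _
  have hgπ : ContMDiffOn 𝓘(ℝ, 𝔼 4) 𝓘(ℝ, 𝔼 4) ∞ (fun w => g (π w)) V := by
    have h1 : ContMDiffOn 𝓘(ℝ, 𝔼 4) (𝓡 4) ∞ (fun w => f (π w)) V :=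
      (hf.comp π.contMDiff).contMDiffOn
    have h2 : ContMDiffOn (𝓡 4) 𝓘(ℝ, 𝔼 4) ∞ φ (chartAt (𝔼 4) (f 0)).source := contMDiffOn_extChartAt
    exact h2.comp h1 fun w hw => hw
  have hΨV : ContMDiffOn 𝓘(ℝ, 𝔼 4) 𝓘(ℝ, 𝔼 4) ∞ Ψ V := by
    have h3 : ContMDiff 𝓘(ℝ, 𝔼 4) 𝓘(ℝ, 𝔼 4) ∞ fun w => A (w - ι (π w)) := by
      rw [contMDiff_iff_contDiff]
      exact A.contDiff.comp (contDiff_id.sub (ι.contDiff.comp π.contDiff))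
    exact hgπ.add h3.contMDiffOn
  have hΨcont : ContinuousOn Ψ V := hΨV.continuousOn
  -- the open set `U₀ = V ∩ Ψ ⁻¹' φ.target ∋ 0` on which `Θ₀` is smooth
  set U₀ : Set (𝔼 4) := V ∩ Ψ ⁻¹' φ.target with hU₀
  have hU₀open : IsOpen U₀ := hΨcont.isOpen_inter_preimage hVopen (isOpen_extChartAt_target (f 0))
  have hΨ0 : Ψ 0 = φ (f 0) := by
    simp only [hΨ, map_zero, sub_zero, add_zero, hg_apply]
  have h0U₀ : (0 : 𝔼 4) ∈ U₀ := ⟨h0V, by rw [mem_preimage, hΨ0]; exact mem_extChartAt_target (f 0)⟩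
  have hΘ₀U₀ : ContMDiffOn 𝓘(ℝ, 𝔼 4) (𝓡 4) ∞ Θ₀ U₀ :=
    (contMDiffOn_extChartAt_symm (f 0)).comp (hΨV.mono inter_subset_left) fun w hw => hw.2
  have hΘ₀0 : Θ₀ 0 = f 0 := by
    change φ.symm (Ψ 0) = f 0
    rw [hΨ0]
    exact extChartAt_to_inv (f 0)
  -- `dΨ₀ = A`
  have hΨA : HasFDerivAt Ψ (A : 𝔼 4 →L[ℝ] 𝔼 4) 0 := by
    have h1 : HasFDerivAt (fun w => g (π w)) (T.comp π) 0 := by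
      have hg' : HasFDerivAt g T (π 0) := by rw [map_zero]; exact hgT
      exact hg'.comp 0 π.hasFDerivAt
    have h2 : HasFDerivAt (fun w : 𝔼 4 => A (w - ι (π w)))
        ((A : 𝔼 4 →L[ℝ] 𝔼 4).comp (ContinuousLinearMap.id ℝ (𝔼 4) - ι.comp π)) 0 :=
      (A : 𝔼 4 →L[ℝ] 𝔼 4).hasFDerivAt.comp 0 ((hasFDerivAt_id 0).sub (ι.comp π).hasFDerivAt)
    refine (h1.add h2).congr_fderiv ?_
    ext w i
    simp only [add_apply, ContinuousLinearMap.comp_apply, sub_apply, ContinuousLinearMap.id_apply, map_sub, ContinuousLinearEquiv.coe_coe, hA]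
    abel_nf
  -- the chart representative of `Θ₀` at `0` is `Ψ` near `0`
  have hwritten : HasFDerivAt (writtenInExtChartAt 𝓘(ℝ, 𝔼 4) (𝓡 4) 0 Θ₀) (A : 𝔼 4 →L[ℝ] 𝔼 4)
      (extChartAt 𝓘(ℝ, 𝔼 4) (0 : 𝔼 4) 0) := by
    rw [ext_chart_model_space_apply]
    refine hΨA.congr_of_eventuallyEq ?_
    filter_upwards [hU₀open.mem_nhds h0U₀] with w hw
    simp only [writtenInExtChartAt, Function.comp_apply, hΘ₀0, extChartAt_model_space_eq_id,
      PartialEquiv.refl_symm, PartialEquiv.refl_coe, id_eq]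
    exact φ.right_inv hw.2
  -- inverse function theorem on manifolds
  obtain ⟨Φ, h0Φ, heq⟩ := isLocalDiffeomorphAt_of_hasFDerivAt_writtenInExtChartAt
    (I := 𝓘(ℝ, 𝔼 4)) (J := 𝓡 4) hU₀open h0U₀ hΘ₀U₀ (by exact_mod_cast le_top) A hwritten
  refine ⟨Φ.toOpenPartialHomeomorph, h0Φ, Φ.contMDiffOn_toFun, Φ.contMDiffOn_invFun, ?_⟩
  -- near `0`, `ι u ∈ Φ.source`, `f u ∈ φ.source`, and there `Φ (ι u) = Θ₀ (ι u) = f u`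
  have h1 : ∀ᶠ u in 𝓝 (0 : 𝔼 2), ι u ∈ Φ.source := by
    have : Φ.source ∈ 𝓝 (ι 0) := by rw [map_zero]; exact Φ.open_source.mem_nhds h0Φ
    exact ι.continuous.continuousAt.preimage_mem_nhds this
  have h2 : ∀ᶠ u in 𝓝 (0 : 𝔼 2), f u ∈ φ.source :=
    hf.continuous.continuousAt.preimage_mem_nhds ((isOpen_extChartAt_source (f 0)).mem_nhds
      (mem_extChartAt_source (f 0)))
  filter_upwards [h1, h2] with u hu hu'
  refine ⟨hu, ?_⟩
  change Φ (ι u) = f u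
  rw [← heq hu]
  change φ.symm (g (π (ι u)) + A (ι u - ι (π (ι u)))) = f u
  rw [π_ι, sub_self, map_zero, add_zero, hg_apply]
  exact φ.left_inv hu'

/-! ### The small ball `Θ ∘ univBall 0 δ` -/

section UnivBall

variable {E : Type*} [NormedAddCommGroup E] [InnerProductSpace ℝ E]

/-- The diffeomorphism `univBall 0 r : E ≅ B(0, r)` of Mathlib is `x ↦ r (1 + ‖x‖²)^{-1/2} x`. [folklore] -/
theorem univBall_zero_apply {r : ℝ} (hr : 0 < r) (x : E) :
    OpenPartialHomeomorph.univBall (0 : E) r x = (r * (√(1 + ‖x‖ ^ 2))⁻¹) • x := by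
  rw [OpenPartialHomeomorph.univBall, dif_pos hr]
  change OpenPartialHomeomorph.unitBallBall (0 : E) r hr (OpenPartialHomeomorph.univUnitBall x) = _
  rw [OpenPartialHomeomorph.unitBallBall_apply, OpenPartialHomeomorph.univUnitBall_apply]
  simp [mul_smul]

/-- `‖univBall 0 r x‖ = r (1 + ‖x‖²)^{-1/2} ‖x‖`. [folklore] -/
theorem norm_univBall_zero {r : ℝ} (hr : 0 < r) (x : E) :
    ‖OpenPartialHomeomorph.univBall (0 : E) r x‖ = r * (√(1 + ‖x‖ ^ 2))⁻¹ * ‖x‖ := by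
  rw [univBall_zero_apply hr, norm_smul, Real.norm_eq_abs, abs_of_pos]
  exact mul_pos hr (inv_pos.2 (Real.sqrt_pos.2 (by positivity)))

/-- `‖univBall 0 r x‖ < r`. [folklore] -/
theorem norm_univBall_zero_lt {r : ℝ} (hr : 0 < r) (x : E) : ‖OpenPartialHomeomorph.univBall (0 : E) r x‖ < r := by
  have h := (OpenPartialHomeomorph.univBall (0 : E) r).map_source (x := x)
    (by rw [OpenPartialHomeomorph.univBall_source]; exact mem_univ x)
  rw [OpenPartialHomeomorph.univBall_target 0 hr, mem_ball_zero_iff] at h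
  exact h

/-- On the closed unit ball, `‖univBall 0 r x‖ ≤ r / √2`. [folklore] -/
theorem norm_univBall_zero_le {r : ℝ} (hr : 0 < r) {x : E} (hx : ‖x‖ ≤ 1) :
    ‖OpenPartialHomeomorph.univBall (0 : E) r x‖ ≤ r * (√2)⁻¹ := by
  rw [norm_univBall_zero hr, mul_assoc]
  refine mul_le_mul_of_nonneg_left ?_ hr.le
  set s := ‖x‖ with hs
  have hs0 : 0 ≤ s := norm_nonneg x
  have h1 : 0 < √(1 + s ^ 2) := Real.sqrt_pos.2 (by positivity)
  have h2 : (0 : ℝ) < √2 := by positivity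
  have key : s * √2 ≤ √(1 + s ^ 2) := by
    rw [show s * √2 = √(s ^ 2 * 2) by rw [Real.sqrt_mul (sq_nonneg s), Real.sqrt_sq hs0]]
    exact Real.sqrt_le_sqrt (by nlinarith)
  calc (√(1 + s ^ 2))⁻¹ * s = s / √(1 + s ^ 2) := by rw [div_eq_inv_mul]
    _ ≤ (√2)⁻¹ := by
      rw [div_le_iff₀ h1, inv_mul_eq_div, le_div_iff₀ h2]
      exact key

/-- On the unit sphere, `univBall 0 r x = (r/√2) x`. [folklore] -/
theorem univBall_zero_apply_of_norm_eq_one {r : ℝ} (hr : 0 < r) {x : E} (hx : ‖x‖ = 1) :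
    OpenPartialHomeomorph.univBall (0 : E) r x = (r * (√2)⁻¹) • x := by
  rw [univBall_zero_apply hr, hx]
  norm_num

end UnivBall

/-- `univBall` commutes with the isometric inclusion `ι : ℝ² → ℝ⁴`: `univBall 0 r (ι u) = ι (univBall 0 r u)`. [folklore] -/
theorem univBall_ι {r : ℝ} (hr : 0 < r) (u : 𝔼 2) :
    OpenPartialHomeomorph.univBall (0 : 𝔼 4) r (ι u) = ι (OpenPartialHomeomorph.univBall (0 : 𝔼 2) r u) := by
  rw [univBall_zero_apply hr, univBall_zero_apply hr, norm_ι, map_smul]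

section SmallBall

variable {P : Type*} [TopologicalSpace P] [ChartedSpace (𝔼 4) P] [IsManifold (𝓡 4) ∞ P]

/-- **A partial diffeomorphism restricted to a small ball is a ball chart.** If `Θ : ℝ⁴ ⇀ P` is an open partial
homeomorphism, `C^∞` with `C^∞` inverse, and `B(0, δ) ⊆ Θ.source`, then `Θ ∘ univBall 0 δ : ℝ⁴ → P` is a smooth embedding
of `ℝ⁴` (onto the open set `Θ(B(0, δ))`): it is the globally defined partial diffeomorphism `univBall 0 δ ≫ Θ`
(`isSmoothEmbedding_of_openPartialHomeomorph`; Lee 2013, Prop. 5.2). [cite: LeeSmoothManifolds2013, Prop. 5.2] -/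
theorem isSmoothEmbedding_comp_univBall (Θ : OpenPartialHomeomorph (𝔼 4) P)
    (hΘ : ContMDiffOn 𝓘(ℝ, 𝔼 4) (𝓡 4) ∞ Θ Θ.source) (hΘ' : ContMDiffOn (𝓡 4) 𝓘(ℝ, 𝔼 4) ∞ Θ.symm Θ.target)
    {δ : ℝ} (hδ : 0 < δ) (hball : Metric.ball (0 : 𝔼 4) δ ⊆ Θ.source) :
    Manifold.IsSmoothEmbedding (𝓡 4) (𝓡 4) ∞ (Θ ∘ OpenPartialHomeomorph.univBall (0 : 𝔼 4) δ) := by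
  set B := OpenPartialHomeomorph.univBall (0 : 𝔼 4) δ with hB
  have hBmem : ∀ x, B x ∈ Θ.source := fun x =>
    hball (by rw [← OpenPartialHomeomorph.univBall_target 0 hδ]; exact B.map_source (by simp [hB]))
  set Λ := B.trans Θ with hΛ
  have hcoe : (Λ : 𝔼 4 → P) = Θ ∘ B := rfl
  have hsrc : Λ.source = univ := by
    rw [hΛ, OpenPartialHomeomorph.trans_source, OpenPartialHomeomorph.univBall_source, univ_inter,
      eq_univ_iff_forall]
    exact hBmem
  rw [← hcoe]
  refine isSmoothEmbedding_of_openPartialHomeomorph Λ hsrc ?_ ?_ (ContinuousLinearEquiv.refl ℝ (𝔼 4))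
  · rw [hsrc, hcoe]
    have hBs : ContMDiff 𝓘(ℝ, 𝔼 4) 𝓘(ℝ, 𝔼 4) ∞ B :=
      (OpenPartialHomeomorph.contDiff_univBall (c := (0 : 𝔼 4)) (r := δ)).contMDiff
    exact hΘ.comp hBs.contMDiffOn fun x _ => hBmem x
  · rw [hΛ, OpenPartialHomeomorph.trans_target]
    have h1 : ContMDiffOn 𝓘(ℝ, 𝔼 4) 𝓘(ℝ, 𝔼 4) ∞ B.symm (Metric.ball (0 : 𝔼 4) δ) :=
      (OpenPartialHomeomorph.contDiffOn_univBall_symm (c := (0 : 𝔼 4)) (r := δ)).contMDiffOn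
    refine h1.comp (hΘ'.mono inter_subset_left) fun y hy => ?_
    have := hy.2
    rwa [mem_preimage, OpenPartialHomeomorph.univBall_target 0 hδ] at this

end SmallBall

/-! ### The radial annulus map of the plane -/

/-- The **radial map** `(x, t) ↦ (a + b t) • x` from `S¹ × ℝ` to the plane: for `b > 0` and `a + b t > 0` on `[1, 2]`
it parametrises the planar annulus `a + b ≤ ‖y‖ ≤ a + 2b` by the cylinder `S¹ × [1, 2]`. [folklore] -/
def radialMap (a b : ℝ) (p : (𝕊 1) × ℝ) : 𝔼 2 :=
  (a + b * p.2) • ((p.1 : 𝕊 1) : 𝔼 2)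

/-- The radial map in coordinates (definitional). [folklore] -/
theorem radialMap_apply (a b : ℝ) (x : 𝕊 1) (t : ℝ) : radialMap a b (x, t) = (a + b * t) • (x : 𝔼 2) := rfl

/-- `‖radialMap a b (x, t)‖ = |a + b t|`. [folklore] -/
theorem norm_radialMap (a b : ℝ) (x : 𝕊 1) (t : ℝ) : ‖radialMap a b (x, t)‖ = |a + b * t| := by
  rw [radialMap_apply, norm_smul, norm_eq_of_mem_sphere, mul_one, Real.norm_eq_abs]

/-- The radial map is jointly `C^∞`. [folklore] -/
theorem contMDiff_radialMap (a b : ℝ) : ContMDiff ((𝓡 1).prod 𝓘(ℝ, ℝ)) 𝓘(ℝ, 𝔼 2) ∞ (radialMap a b) :=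
  ((contDiff_const.add (contDiff_const.mul contDiff_id)).comp_contMDiff contMDiff_snd).smul
    ((contMDiff_coe_sphere (n := 1)).comp contMDiff_fst)

/-- The radial map is injective on `S¹ × [1, 2]` when `b > 0` and `a + b > 0` (the radius `a + b t` recovers `t`).
[folklore] -/
theorem injOn_radialMap {a b : ℝ} (hb : 0 < b) (hab : 0 < a + b) :
    InjOn (radialMap a b) (univ ×ˢ Icc 1 2) := by
  rintro ⟨x, t⟩ ⟨-, ht⟩ ⟨x', t'⟩ ⟨-, ht'⟩ h
  have hpos : ∀ s ∈ Icc (1 : ℝ) 2, 0 < a + b * s := fun s hs => by nlinarith [hs.1]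
  have htt : t = t' := by
    have hn := congrArg (fun z ↦ ‖z‖) h
    simp only [norm_radialMap, abs_of_pos (hpos t ht), abs_of_pos (hpos t' ht')] at hn
    nlinarith
  subst htt
  rw [radialMap_apply, radialMap_apply] at h
  have h1 := smul_right_injective (𝔼 2) (hpos t ht).ne' h
  rw [Subtype.ext h1]

/-- **The radial map is an immersion** wherever `b ≠ 0` and `a + b t ≠ 0`: its differential sends `(v, σ)` to
`(a + b t) • dι(v) + σ b • x`, and `dι(v) ⟂ x` (tangent vectors of the circle are orthogonal to the radius), so pairing
with `x` forces `σ = 0` and then `v = 0`. [folklore] -/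
theorem injective_mfderiv_radialMap {a b : ℝ} (hb : b ≠ 0) (x : 𝕊 1) {t : ℝ} (ht : a + b * t ≠ 0) :
    Function.Injective (mfderiv ((𝓡 1).prod 𝓘(ℝ, ℝ)) 𝓘(ℝ, 𝔼 2) (radialMap a b) (x, t)) := by
  have hn0 : (∞ : ℕ∞ω) ≠ 0 := by simp
  set Dι := mfderiv (𝓡 1) 𝓘(ℝ, 𝔼 2) (Subtype.val : (𝕊 1) → 𝔼 2) x with hDι
  have hι_inj : Function.Injective Dι := mfderiv_coe_sphere_injective (n := 1) x
  have hιd : HasMFDerivAt (𝓡 1) 𝓘(ℝ, 𝔼 2) (Subtype.val : (𝕊 1) → 𝔼 2) x Dι :=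
    ((contMDiff_coe_sphere (n := 1)).mdifferentiableAt hn0).hasMFDerivAt
  -- the partial derivative in `x`
  have hA : mfderiv (𝓡 1) 𝓘(ℝ, 𝔼 2) (fun z : 𝕊 1 ↦ radialMap a b (z, t)) x = (a + b * t) • Dι := by
    have heq : (fun z : 𝕊 1 ↦ radialMap a b (z, t)) = (a + b * t) • (Subtype.val : (𝕊 1) → 𝔼 2) := rfl
    rw [heq, const_smul_mfderiv hιd.mdifferentiableAt, hιd.mfderiv]
  -- the partial derivative in `t`
  have hd2 : HasDerivAt (fun s : ℝ ↦ (a + b * s) • (x : 𝔼 2)) (b • (x : 𝔼 2)) t := by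
    have h := ((hasDerivAt_id' t).const_mul b).const_add a
    simpa using h.smul_const (x : 𝔼 2)
  have hB : ∀ σ : ℝ, mfderiv 𝓘(ℝ, ℝ) 𝓘(ℝ, 𝔼 2) (fun s : ℝ ↦ radialMap a b (x, s)) t σ = σ • (b • (x : 𝔼 2)) := by
    intro σ
    have heq : (fun s : ℝ ↦ radialMap a b (x, s)) = fun s ↦ (a + b * s) • (x : 𝔼 2) := rfl
    rw [heq, mfderiv_eq_fderiv, hd2.hasFDerivAt.fderiv]
    rfl
  -- the total differential
  have hf : MDifferentiableAt ((𝓡 1).prod 𝓘(ℝ, ℝ)) 𝓘(ℝ, 𝔼 2) (radialMap a b) (x, t) :=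
    (contMDiff_radialMap a b).mdifferentiableAt hn0
  rw [injective_iff_map_eq_zero]
  intro v hv
  obtain ⟨W, hWdef⟩ : ∃ W : 𝔼 2, W = Dι v.1 := ⟨_, rfl⟩
  have key : mfderiv ((𝓡 1).prod 𝓘(ℝ, ℝ)) 𝓘(ℝ, 𝔼 2) (radialMap a b) (x, t) v =
      (a + b * t) • W + v.2 • (b • (x : 𝔼 2)) := by
    rw [mfderiv_prod_eq_add_apply hf]
    dsimp only
    rw [hA, hB, hWdef]
    rfl
  rw [key] at hv
  have hv' : (a + b * t) • W + v.2 • (b • (x : 𝔼 2)) = (0 : 𝔼 2) := hv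
  -- pair with `x`
  have hW : inner ℝ (x : 𝔼 2) W = 0 := by
    have hmem : W ∈ (ℝ ∙ (x : 𝔼 2))ᗮ := by
      rw [hWdef, ← range_mfderiv_coe_sphere (n := 1) x]
      exact ⟨v.1, rfl⟩
    exact (Submodule.mem_orthogonal_singleton_iff_inner_right).mp hmem
  have hxx : inner ℝ (x : 𝔼 2) (x : 𝔼 2) = 1 := by
    rw [real_inner_self_eq_norm_sq, norm_eq_of_mem_sphere, one_pow]
  have h2 : v.2 = 0 := by
    have h := congrArg (fun z ↦ inner ℝ (x : 𝔼 2) z) hv'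
    simp only [inner_add_right, inner_smul_right, inner_zero_right, hW, hxx, mul_zero, zero_add,
      mul_one] at h
    rcases mul_eq_zero.1 h with h | h
    · exact h
    · exact absurd h hb
  rw [h2, zero_smul, add_zero] at hv'
  have hW0 : W = 0 := (smul_eq_zero.mp hv').resolve_left ht
  rw [hWdef] at hW0
  have e2 : v.1 = 0 := (injective_iff_map_eq_zero Dι).1 hι_inj _ hW0
  exact Prod.ext e2 h2

/-! ### Puncturing a slice disc: the small adapted ball -/

section Core

variable {P : Type*} [TopologicalSpace P] [T2Space P] [ChartedSpace (𝔼 4) P] [IsManifold (𝓡 4) ∞ P]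

/-- **The small adapted ball.** Let `f|_{𝔻²}` be a proper slice disc for `K` off the ball `e` in `P`
(`Knot.IsSliceDiscIn`) and `N` an open neighbourhood of the centre `f 0`.  Then for some `δ ∈ (0, 1)` there is a smooth
embedding `e₁ : ℝ⁴ ↪ P` with image in `N` which is ADAPTED to the disc: `e₁ (ι u) = f (univBall 0 δ u)` for all
`u ∈ ℝ²` (so `e₁` carries the coordinate plane `ι(ℝ²)` onto the central part `f(B(0, δ))` of the disc and the round unit
circle of that plane onto the circle `f(‖x‖ = δ/√2)`), and whose closed unit ball meets the disc `f(𝔻²)` only in that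
central part: `f x ∈ e₁(𝔻⁴)`, `‖x‖ ≤ 1` force `‖x‖ ≤ δ/√2`.  (`e₁ = Θ ∘ univBall 0 δ` for the adapted chart `Θ` of
`exists_adaptedChart` and `δ` small: `Θ(B(0, δ))` lies in `N` and misses the compact set `f(𝔻² ∖ B(0, R₀))`.)
[cite: LeeSmoothManifolds2013, Thm. 4.12 and Prop. 5.2] -/
theorem exists_adaptedBall {K : Knot} {e : 𝔼 4 → P} {f : 𝔼 2 → P} (h : K.IsSliceDiscIn P e f)
    {N : Set P} (hN : IsOpen N) (h0N : f 0 ∈ N) :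
    ∃ (δ : ℝ) (e₁ : 𝔼 4 → P), 0 < δ ∧ δ < 1 ∧ Manifold.IsSmoothEmbedding (𝓡 4) (𝓡 4) ∞ e₁ ∧ (∀ v, e₁ v ∈ N) ∧
      (∀ u : 𝔼 2, e₁ (ι u) = f (OpenPartialHomeomorph.univBall (0 : 𝔼 2) δ u)) ∧
      ∀ x : 𝔼 2, ‖x‖ ≤ 1 → f x ∈ e₁ '' Metric.closedBall (0 : 𝔼 4) 1 → ‖x‖ ≤ δ * (√2)⁻¹ := by
  obtain ⟨hemb, hf, hinj, himm, hproper, hbdry⟩ := h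
  -- the adapted chart `Θ` at `f 0`
  obtain ⟨Θ, h0Θ, hΘ, hΘ', hev⟩ := exists_adaptedChart hf (himm 0 (by simp))
  obtain ⟨R₀, hR₀, hR⟩ : ∃ R₀ > 0, ∀ u : 𝔼 2, ‖u‖ < R₀ → ι u ∈ Θ.source ∧ Θ (ι u) = f u := by
    obtain ⟨ε, hε, hball⟩ := Metric.eventually_nhds_iff_ball.1 hev
    exact ⟨ε, hε, fun u hu => hball u (mem_ball_zero_iff.2 hu)⟩
  have hΘ0 : Θ 0 = f 0 := by
    have := (hR 0 (by simpa using hR₀)).2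
    rwa [map_zero] at this
  -- the compact set `C = f(𝔻² ∖ B(0, R₀))`, which misses `f 0`
  set C : Set P := f '' (Metric.closedBall (0 : 𝔼 2) 1 \ Metric.ball 0 R₀) with hC
  have hCcomp : IsCompact C := ((isCompact_closedBall (0 : 𝔼 2) 1).diff Metric.isOpen_ball).image hf.continuous
  have h0C : f 0 ∉ C := by
    rintro ⟨x, ⟨hx1, hx2⟩, hx⟩
    have : x = 0 := hinj hx1 (by simp) hx
    subst this
    exact hx2 (Metric.mem_ball_self hR₀)
  -- the open neighbourhood `N' = N ∖ C` of `Θ 0 = f 0` and a ball `B(0, δ₀)` mapped into it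
  set N' : Set P := N ∩ Cᶜ with hN'
  have hN'open : IsOpen N' := hN.inter hCcomp.isClosed.isOpen_compl
  have h0N' : Θ 0 ∈ N' := by rw [hΘ0]; exact ⟨h0N, h0C⟩
  obtain ⟨δ₀, hδ₀, hδ₀sub⟩ : ∃ δ₀ > 0, Metric.ball (0 : 𝔼 4) δ₀ ⊆ Θ.source ∩ Θ ⁻¹' N' := by
    have hopen : IsOpen (Θ.source ∩ Θ ⁻¹' N') := Θ.continuousOn.isOpen_inter_preimage Θ.open_source hN'open
    exact Metric.isOpen_iff.1 hopen 0 ⟨h0Θ, h0N'⟩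
  -- the radius `δ`
  set δ : ℝ := min (min δ₀ R₀) 1 / 2 with hδdef
  have hδ : 0 < δ := by positivity
  have hδδ₀ : δ < δ₀ := by
    have : min (min δ₀ R₀) 1 ≤ δ₀ := (min_le_left _ _).trans (min_le_left _ _)
    rw [hδdef]; linarith
  have hδR₀ : δ < R₀ := by
    have : min (min δ₀ R₀) 1 ≤ R₀ := (min_le_left _ _).trans (min_le_right _ _)
    rw [hδdef]; linarith
  have hδ1 : δ < 1 := by
    have : min (min δ₀ R₀) 1 ≤ 1 := min_le_right _ _
    rw [hδdef]; linarith
  have hballsrc : Metric.ball (0 : 𝔼 4) δ ⊆ Θ.source := fun w hw =>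
    (hδ₀sub (Metric.ball_subset_ball hδδ₀.le hw)).1
  have hballN' : ∀ w ∈ Metric.ball (0 : 𝔼 4) δ, Θ w ∈ N' := fun w hw =>
    (hδ₀sub (Metric.ball_subset_ball hδδ₀.le hw)).2
  -- the small ball `e₁ = Θ ∘ univBall 0 δ`
  set B := OpenPartialHomeomorph.univBall (0 : 𝔼 4) δ with hB
  have hBball : ∀ v, B v ∈ Metric.ball (0 : 𝔼 4) δ := fun v => mem_ball_zero_iff.2 (norm_univBall_zero_lt hδ v)
  refine ⟨δ, Θ ∘ B, hδ, hδ1, isSmoothEmbedding_comp_univBall Θ hΘ hΘ' hδ hballsrc, fun v => (hballN' _ (hBball v)).1,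
    fun u => ?_, fun x hx1 hx => ?_⟩
  · -- the formula `e₁ (ι u) = f (univBall 0 δ u)`
    have hu : ‖OpenPartialHomeomorph.univBall (0 : 𝔼 2) δ u‖ < R₀ := (norm_univBall_zero_lt hδ u).trans hδR₀
    rw [Function.comp_apply, hB, univBall_ι hδ]
    exact (hR _ hu).2
  · -- the closed unit ball of `e₁` meets the disc only in its central part
    obtain ⟨y, hy, hxy⟩ := hx
    rw [mem_closedBall_zero_iff] at hy
    set w := B y with hw
    have hwδ : ‖w‖ ≤ δ * (√2)⁻¹ := norm_univBall_zero_le hδ hy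
    have hwsrc : w ∈ Θ.source := hballsrc (hBball y)
    by_cases hxR : ‖x‖ < R₀
    · obtain ⟨hιsrc, hΘι⟩ := hR x hxR
      have heq : Θ (ι x) = Θ w := by rw [hΘι]; exact hxy.symm
      have : ι x = w := Θ.injOn hιsrc hwsrc heq
      rw [← norm_ι x, this]
      exact hwδ
    · exfalso
      have hxC : f x ∈ C := ⟨x, ⟨mem_closedBall_zero_iff.2 hx1, fun h => hxR (mem_ball_zero_iff.1 h)⟩, rfl⟩
      have hxN' : f x ∈ N' := by rw [← hxy]; exact hballN' _ (hBball y)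
      exact hxN'.2 hxC

omit [T2Space P] [IsManifold (𝓡 4) ∞ P] in
/-- **The punctured disc is a concordance from the unknot.**  Let `f|_{𝔻²}` be a proper slice disc for `K` off the ball
`e`, and `e₁ : ℝ⁴ ↪ P` a smooth ball chart whose closed unit ball is disjoint from `e(𝔻⁴)`, adapted to the disc
(`e₁ (ι u) = f (univBall 0 δ u)`, `0 < δ < 1`) and meeting `f(𝔻²)` only in its central part.  Then the annulus
`(x, t) ↦ f (r(t) • x)` with `r` affine, `r(1) = δ/√2`, `r(2) = 1`, is a concordance datum in `P` from the round UNKNOT on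
`e₁(S³)` (indeed `e₁ ∘ unknot = e₁ ∘ ι|_{S¹} = f((δ/√2) • ·)`) to `K` on `e(S³)` (`f|_{S¹} = e ∘ K`): it is smooth,
injective and immersive on `S¹ × [1, 2]` (the radial map is, `injective_mfderiv_radialMap`, and `f` is an injective
immersion on `𝔻²`), and for `t ∈ (1, 2)` the radius lies in `(δ/√2, 1)`, off both closed balls.  This is the surface
`Σ° = Σ ∖ (small disc)` of MMSW's puncturing arguments (proofs of Thm. 6.14 and Prop. 7.6 (v)).
[cite: ManolescuMarengonSarkarWillis2023, proof of Thm. 6.14] -/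
theorem isConcordanceIn_unknot_of_adapted {K : Knot} {e : 𝔼 4 → P} {f : 𝔼 2 → P} (h : K.IsSliceDiscIn P e f)
    {e₁ : 𝔼 4 → P} (he₁ : Manifold.IsSmoothEmbedding (𝓡 4) (𝓡 4) ∞ e₁)
    (hdisj : Disjoint (e₁ '' Metric.closedBall (0 : 𝔼 4) 1) (e '' Metric.closedBall (0 : 𝔼 4) 1))
    {δ : ℝ} (hδ : 0 < δ) (hδ1 : δ < 1)
    (hformula : ∀ u : 𝔼 2, e₁ (ι u) = f (OpenPartialHomeomorph.univBall (0 : 𝔼 2) δ u))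
    (hcentral : ∀ x : 𝔼 2, ‖x‖ ≤ 1 → f x ∈ e₁ '' Metric.closedBall (0 : 𝔼 4) 1 → ‖x‖ ≤ δ * (√2)⁻¹) :
    IsConcordanceIn unknot K P e₁ e (f ∘ radialMap (2 * (δ * (√2)⁻¹) - 1) (1 - δ * (√2)⁻¹)) := by
  obtain ⟨hemb, hf, hinj, himm, hproper, hbdry⟩ := h
  set ρ₀ : ℝ := δ * (√2)⁻¹ with hρ₀
  have hρ₀pos : 0 < ρ₀ := by positivity
  have hρ₀lt : ρ₀ < 1 := by
    have h2 : (√2)⁻¹ < 1 := by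
      rw [inv_lt_one_iff₀]
      exact Or.inr (by rw [Real.lt_sqrt (by norm_num)]; norm_num)
    calc ρ₀ = δ * (√2)⁻¹ := rfl
      _ < 1 * 1 := mul_lt_mul'' hδ1 h2 hδ.le (by positivity)
      _ = 1 := one_mul 1
  set a : ℝ := 2 * ρ₀ - 1 with ha
  set b : ℝ := 1 - ρ₀ with hb
  have hbpos : 0 < b := by rw [hb]; linarith
  -- the radius `r(t) = a + b t` on `[1, 2]`: `r(1) = ρ₀`, `r(2) = 1`, and `ρ₀ ≤ r ≤ 1`
  have hr1 : a + b * 1 = ρ₀ := by rw [ha, hb]; ring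
  have hr2 : a + b * 2 = 1 := by rw [ha, hb]; ring
  have hrIcc : ∀ t ∈ Icc (1 : ℝ) 2, ρ₀ ≤ a + b * t ∧ a + b * t ≤ 1 := fun t ht =>
    ⟨by nlinarith [ht.1], by nlinarith [ht.2]⟩
  have hrIoo : ∀ t ∈ Ioo (1 : ℝ) 2, ρ₀ < a + b * t ∧ a + b * t < 1 := fun t ht =>
    ⟨by nlinarith [ht.1], by nlinarith [ht.2]⟩
  have hrpos : ∀ t ∈ Icc (1 : ℝ) 2, 0 < a + b * t := fun t ht => hρ₀pos.trans_le (hrIcc t ht).1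
  -- the radial map lands in `𝔻²` on `S¹ × [1, 2]`
  have hmemD : ∀ (x : 𝕊 1) (t : ℝ), t ∈ Icc (1 : ℝ) 2 →
      radialMap a b (x, t) ∈ Metric.closedBall (0 : 𝔼 2) 1 := fun x t ht => by
    rw [mem_closedBall_zero_iff, norm_radialMap, abs_of_pos (hrpos t ht)]
    exact (hrIcc t ht).2
  refine ⟨he₁, hemb, hdisj, hf.comp (contMDiff_radialMap a b), ?_, ?_, ?_, ?_, ?_⟩
  · -- injective on `S¹ × [1, 2]`
    rintro ⟨x, t⟩ ⟨-, ht⟩ ⟨x', t'⟩ ⟨-, ht'⟩ hxt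
    have h1 : radialMap a b (x, t) = radialMap a b (x', t') := hinj (hmemD x t ht) (hmemD x' t' ht') hxt
    exact injOn_radialMap hbpos (by rw [ha, hb]; linarith) ⟨mem_univ _, ht⟩ ⟨mem_univ _, ht'⟩ h1
  · -- immersion on `S¹ × [1, 2]`
    rintro ⟨x, t⟩ ⟨-, ht⟩
    have hn0 : (∞ : ℕ∞ω) ≠ 0 := by simp
    have hfd : MDifferentiableAt (𝓡 2) (𝓡 4) f (radialMap a b (x, t)) := (hf _).mdifferentiableAt hn0
    have hgd : MDifferentiableAt ((𝓡 1).prod 𝓘(ℝ, ℝ)) 𝓘(ℝ, 𝔼 2) (radialMap a b) (x, t) :=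
      (contMDiff_radialMap a b (x, t)).mdifferentiableAt hn0
    rw [mfderiv_comp (x, t) hfd hgd]
    exact (himm _ (hmemD x t ht)).comp (injective_mfderiv_radialMap hbpos.ne' x (hrpos t ht).ne')
  · -- the open annulus misses both closed balls
    intro x t ht hmem
    have hr := hrIoo t ht
    have hrpos' : 0 < a + b * t := hρ₀pos.trans hr.1
    have hnorm : ‖radialMap a b (x, t)‖ = a + b * t := by rw [norm_radialMap, abs_of_pos hrpos']
    rcases hmem with hmem | hmem
    · have := hcentral (radialMap a b (x, t)) (by rw [hnorm]; exact hr.2.le) hmem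
      rw [hnorm] at this
      exact absurd this (not_le.2 hr.1)
    · exact hproper (radialMap a b (x, t)) (by rw [hnorm]; exact hr.2) hmem
  · -- starts at the unknot on `e₁(S³)`
    intro x
    have hx : ‖(x : 𝔼 2)‖ = 1 := norm_eq_of_mem_sphere x
    change f (radialMap a b (x, 1)) = e₁ (ι (x : 𝔼 2))
    rw [hformula, univBall_zero_apply_of_norm_eq_one hδ hx, radialMap_apply, hr1]
  · -- ends at `K` on `e(S³)`
    intro x
    change f (radialMap a b (x, 2)) = e (K x)
    rw [radialMap_apply, hr2, one_smul]
    exact hbdry x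

omit [T2Space P] [IsManifold (𝓡 4) ∞ P] in
/-- **Reflecting the adapted ball.**  Precomposing `e₁` with the reflection `ρ = reflectLastCLM 3` of `ℝ⁴` (which fixes
`ι(ℝ²)` pointwise and preserves the unit ball) keeps all the properties used above. [folklore] -/
theorem adapted_comp_reflectLastCLM {e : 𝔼 4 → P} {f : 𝔼 2 → P} {e₁ : 𝔼 4 → P}
    (he₁ : Manifold.IsSmoothEmbedding (𝓡 4) (𝓡 4) ∞ e₁)
    (hdisj : Disjoint (e₁ '' Metric.closedBall (0 : 𝔼 4) 1) (e '' Metric.closedBall (0 : 𝔼 4) 1))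
    {δ : ℝ} (hformula : ∀ u : 𝔼 2, e₁ (ι u) = f (OpenPartialHomeomorph.univBall (0 : 𝔼 2) δ u))
    (hcentral : ∀ x : 𝔼 2, ‖x‖ ≤ 1 → f x ∈ e₁ '' Metric.closedBall (0 : 𝔼 4) 1 → ‖x‖ ≤ δ * (√2)⁻¹) :
    Manifold.IsSmoothEmbedding (𝓡 4) (𝓡 4) ∞ (e₁ ∘ reflectLastCLM 3) ∧
      Disjoint ((e₁ ∘ reflectLastCLM 3) '' Metric.closedBall (0 : 𝔼 4) 1) (e '' Metric.closedBall (0 : 𝔼 4) 1) ∧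
      (∀ u : 𝔼 2, (e₁ ∘ reflectLastCLM 3) (ι u) = f (OpenPartialHomeomorph.univBall (0 : 𝔼 2) δ u)) ∧
      ∀ x : 𝔼 2, ‖x‖ ≤ 1 → f x ∈ (e₁ ∘ reflectLastCLM 3) '' Metric.closedBall (0 : 𝔼 4) 1 → ‖x‖ ≤ δ * (√2)⁻¹ := by
  have hsub : (e₁ ∘ reflectLastCLM 3) '' Metric.closedBall (0 : 𝔼 4) 1 ⊆ e₁ '' Metric.closedBall (0 : 𝔼 4) 1 := by
    rintro _ ⟨y, hy, rfl⟩
    refine ⟨reflectLastCLM 3 y, ?_, rfl⟩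
    rw [mem_closedBall_zero_iff] at hy ⊢
    rwa [norm_reflectLastCLM]
  let R : 𝔼 4 ≃L[ℝ] 𝔼 4 :=
    ContinuousLinearEquiv.equivOfInverse (reflectLastCLM 3) (reflectLastCLM 3)
      (reflectLastCLM_reflectLastCLM 3) (reflectLastCLM_reflectLastCLM 3)
  have hR : (e₁ ∘ reflectLastCLM 3) = e₁ ∘ R.toDiffeomorph := rfl
  refine ⟨?_, hdisj.mono_left hsub, fun u => ?_, fun x hx1 hx => hcentral x hx1 (hsub hx)⟩
  · rw [hR]
    exact he₁.comp_diffeomorph R.toDiffeomorph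
  · rw [Function.comp_apply, reflectLastCLM_ι]
    exact hformula u

end Core

end Puncture

/-! ### Puncturing: tower-slice over `o` gives tower-concordant from the unknot over `-o` -/

/-- **Puncturing an H-slice disc** (the step *"after puncturing … we get a cobordism `Σ°` … from the unknot `U`"* of
MMSW's proofs of Thm. 6.14 / Prop. 7.6 (v), here inside an `o`-tower): if `K` is tower-slice over `o` — a proper disc
`f|_{𝔻²}` off an orientation-preserving ball `e` in an `o`-tower `(P, oP)`, inside an open `U` with `H₂(U; ℤ) = 0` — then
`K` is tower-concordant FROM THE UNKNOT over `-o`: in the reversed tower `(P, -oP)` (a `(-o)`-tower,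
`IsProjectiveTower.neg`) the original ball `e` is orientation REVERSING, a small ball `e₁ ⊂ U ∖ e(𝔻⁴)` adapted to the disc
at `f 0` (`Puncture.exists_adaptedBall`), reflected if necessary so as to be orientation PRESERVING towards `-oP` (a disc
preserves or reverses orientation, `isOrientationPreserving_or_isOrientationReversing_disc`; the reflection fixes the
coordinate plane and the unknot), bounds together with `e` the annulus cut out of the disc
(`Puncture.isConcordanceIn_unknot_of_adapted`), and everything stays inside `U`.
[cite: ManolescuMarengonSarkarWillis2023, Remark 6.1, Thm. 6.11 and proof of Thm. 6.14] -/
theorem IsTowerSlice.isTowerConcordant_unknot {o : SmoothOrientation (𝓡 4) ComplexProjectivePlane} {K : Knot}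
    (h : K.IsTowerSlice o) : IsTowerConcordant (-o) unknot K := by
  obtain ⟨t, P, _, _, _, _, _, _, oP, e, f, hT, hef, he, U, heU, hfU, hU⟩ := h
  -- the open neighbourhood `N = U ∖ e(𝔻⁴)` of `f 0`
  have hclosed : IsClosed (e '' Metric.closedBall (0 : EuclideanSpace ℝ (Fin 4)) 1) :=
    ((isCompact_closedBall _ _).image hef.isSmoothEmbedding.contMDiff.continuous).isClosed
  set N : Set P := (U : Set P) ∩ (e '' Metric.closedBall (0 : EuclideanSpace ℝ (Fin 4)) 1)ᶜ with hN
  have hNopen : IsOpen N := U.isOpen.inter hclosed.isOpen_compl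
  have h0N : f 0 ∈ N := ⟨hfU 0, hef.apply_notMem (by simp)⟩
  -- the small adapted ball, made orientation preserving towards `-oP`
  obtain ⟨δ, e₁, hδ, hδ1, he₁, he₁N, hformula, hcentral⟩ := Puncture.exists_adaptedBall hef hNopen h0N
  have hdisj : Disjoint (e₁ '' Metric.closedBall (0 : EuclideanSpace ℝ (Fin 4)) 1)
      (e '' Metric.closedBall (0 : EuclideanSpace ℝ (Fin 4)) 1) := by
    refine disjoint_left.2 ?_
    rintro _ ⟨v, -, rfl⟩ hv
    exact (he₁N v).2 hv
  obtain ⟨e₁', he₁', hdisj', hformula', hcentral', he₁'N, hor⟩ :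
      ∃ e₁' : EuclideanSpace ℝ (Fin 4) → P, Manifold.IsSmoothEmbedding (𝓡 4) (𝓡 4) ∞ e₁' ∧
        Disjoint (e₁' '' Metric.closedBall (0 : EuclideanSpace ℝ (Fin 4)) 1)
          (e '' Metric.closedBall (0 : EuclideanSpace ℝ (Fin 4)) 1) ∧
        (∀ u, e₁' (Puncture.ι u) = f (OpenPartialHomeomorph.univBall (0 : EuclideanSpace ℝ (Fin 2)) δ u)) ∧
        (∀ x : EuclideanSpace ℝ (Fin 2), ‖x‖ ≤ 1 →
          f x ∈ e₁' '' Metric.closedBall (0 : EuclideanSpace ℝ (Fin 4)) 1 → ‖x‖ ≤ δ * (√2)⁻¹) ∧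
        (∀ v, e₁' v ∈ N) ∧ IsOrientationPreserving (SmoothOrientation.euclidean 4) (-oP) e₁' := by
    rcases isOrientationPreserving_or_isOrientationReversing_disc he₁ (isOpenMap_disc he₁).isOpen_range
        (euclideanOrientation 4) (-oP) with hpres | hrev
    · exact ⟨e₁, he₁, hdisj, hformula, hcentral, he₁N, hpres⟩
    · obtain ⟨h1, h2, h3, h4⟩ := Puncture.adapted_comp_reflectLastCLM he₁ hdisj hformula hcentral
      refine ⟨e₁ ∘ reflectLastCLM 3, h1, h2, h3, h4, fun v => he₁N _, ?_⟩
      -- the reflected ball preserves `(standard, -oP)`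
      let R : EuclideanSpace ℝ (Fin 4) ≃L[ℝ] EuclideanSpace ℝ (Fin 4) :=
        ContinuousLinearEquiv.equivOfInverse (reflectLastCLM 3) (reflectLastCLM 3)
          (reflectLastCLM_reflectLastCLM 3) (reflectLastCLM_reflectLastCLM 3)
      have hRdet : LinearMap.det (R.toLinearEquiv :
          EuclideanSpace ℝ (Fin 4) →ₗ[ℝ] EuclideanSpace ℝ (Fin 4)) < 0 := by
        have hR : (R.toLinearEquiv : EuclideanSpace ℝ (Fin 4) →ₗ[ℝ] EuclideanSpace ℝ (Fin 4)) =
            ((reflectLastCLM 3 : EuclideanSpace ℝ (Fin 4) →L[ℝ] EuclideanSpace ℝ (Fin 4)) :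
              EuclideanSpace ℝ (Fin 4) →ₗ[ℝ] EuclideanSpace ℝ (Fin 4)) := rfl
        rw [hR, det_reflectLastCLM]
        norm_num
      have hrev' : IsOrientationPreserving (SmoothOrientation.modelSpace (-euclideanOrientation 4)) (-oP) e₁ := by
        rw [← SmoothOrientation.neg_modelSpace, ← isOrientationReversing_iff_neg]
        exact hrev
      exact isOrientationPreserving_disc_comp_linear_of_det_neg he₁ hrev' R hRdet
  -- the annulus and the assembly in the reversed tower `(P, -oP)`
  have hconc := Puncture.isConcordanceIn_unknot_of_adapted hef he₁' hdisj' hδ hδ1 hformula' hcentral'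
  have he' : IsOrientationReversing (SmoothOrientation.euclidean 4) (-oP) e := by
    rw [isOrientationReversing_iff, neg_neg]
    exact he
  refine hconc.isTowerConcordant (IsProjectiveTower.neg o t P oP hT) hor he' U (fun v => (he₁'N v).1) heU
    (fun p => hfU _) hU

/-! ### Cor. 1.9 (knots) from the relative inequality (Thm. 1.8 / 6.11, cylinder case) -/

/-- **MMSW Cor. 1.9 for knots from Thm. 6.11 for cylinders, one chirality.**  If `s` is antitone under tower-concordance
over `o` (`RasmussenAntitoneOver o`, the content of MMSW Thm. 1.8 = Thm. 6.11 for two knots and a null-homologous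
cylinder in a twice-punctured `o`-tower), then every knot tower-slice over `-o` has all its Rasmussen invariants `≤ 0`:
puncture the H-slice disc (`IsTowerSlice.isTowerConcordant_unknot`: `K` is tower-concordant from the unknot over
`- -o = o`) and use `s(unknot) = 0` (`hasRasmussenInvariant_unknot_holds`).  This is the source's *"by further
specializing to the case `L₁ = ∅` (for which `s = 1`), we obtain the adjunction inequality"*, with the empty link replaced
by a small unknot. [cite: ManolescuMarengonSarkarWillis2023, Thm. 6.11, Cor. 6.12 and Cor. 6.13] -/
theorem rasmussen_nonpos_of_isTowerSlice_of_rasmussenAntitoneOver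
    {o : SmoothOrientation (𝓡 4) ComplexProjectivePlane} (h : RasmussenAntitoneOver o) (K : Knot)
    (hK : K.IsTowerSlice (-o)) (s : ℤ) (hs : K.HasRasmussenInvariant s) : s ≤ 0 := by
  have h1 : IsTowerConcordant o unknot K := by simpa using hK.isTowerConcordant_unknot
  exact h unknot K h1 0 s hasRasmussenInvariant_unknot_holds hs

/-- **MMSW Cor. 1.9 for knots (the named fact `Knot.rasmussen_nonpos_of_isTowerSlice`) from Thm. 1.8 / 6.11 for
cylinders**, `∃ o` form: if for SOME orientation `o` of `ℂℙ²` the Rasmussen invariant is antitone under tower-concordance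
over `o`, then for some orientation (namely `-o`) every tower-slice knot has `s ≤ 0`.  So the named fact is reduced to
the cylinder case of the printed Thm. 6.11, the puncturing being done once and for all in
`IsTowerSlice.isTowerConcordant_unknot`. [cite: ManolescuMarengonSarkarWillis2023, Thm. 1.8, Thm. 6.11 and Cor. 1.9] -/
theorem rasmussen_nonpos_of_isTowerSlice_of_exists_rasmussenAntitoneOver
    (h : ∃ o : SmoothOrientation (𝓡 4) ComplexProjectivePlane, RasmussenAntitoneOver o) :
    Knot.rasmussen_nonpos_of_isTowerSlice := by
  obtain ⟨o, ho⟩ := h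
  exact ⟨-o, fun K hK s hs =>
    rasmussen_nonpos_of_isTowerSlice_of_rasmussenAntitoneOver ho K (by simpa using hK) s hs⟩

/-- **… and hence Rasmussen's slice theorem.**  Under the same hypothesis every smoothly slice knot has `s = 0`
(`Literature.Topology.FourManifolds.eq_zero_of_isSmoothlySlice`, Rasmussen 2010 Thm. 1), through
`rasmussen_nonpos_of_isTowerSlice.eq_zero_of_isSmoothlySlice` (`ProjectiveTowersProofs.lean`).
[cite: ManolescuMarengonSarkarWillis2023, Thm. 6.14] [cite: Rasmussen2010, Thm. 1] -/
theorem eq_zero_of_isSmoothlySlice_of_exists_rasmussenAntitoneOver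
    (h : ∃ o : SmoothOrientation (𝓡 4) ComplexProjectivePlane, RasmussenAntitoneOver o) :
    eq_zero_of_isSmoothlySlice :=
  (rasmussen_nonpos_of_isTowerSlice_of_exists_rasmussenAntitoneOver h).eq_zero_of_isSmoothlySlice

/-! ### The `∃ o` form absorbs the incoming/outgoing convention -/

/-- **Exchanging the roles of the two punctures is the same as reversing `o`.**  A concordance datum in an `o`-tower
`(P, oP)` whose FIRST ball is orientation reversing and whose SECOND ball is orientation preserving is, in the reversed
tower `(P, -oP)` (a `(-o)`-tower, `IsProjectiveTower.neg`), a datum of the shape required by `IsTowerConcordant (-o)`.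
[cite: ManolescuMarengonSarkarWillis2023, §6 (orientation conventions) and Remark 6.6] -/
theorem isTowerConcordant_neg_of_swapped {o : SmoothOrientation (𝓡 4) ComplexProjectivePlane} {K₁ K₂ : Knot}
    {t : ℕ} {P : Type} [TopologicalSpace P] [T2Space P] [SecondCountableTopology P]
    [ChartedSpace (EuclideanSpace ℝ (Fin 4)) P] [IsManifold (𝓡 4) ∞ P] [CompactSpace P]
    {oP : SmoothOrientation (𝓡 4) P} {e₁ e₂ : EuclideanSpace ℝ (Fin 4) → P} {F : (𝕊 1) × ℝ → P}
    (hT : IsProjectiveTower o t P oP) (h : IsConcordanceIn K₁ K₂ P e₁ e₂ F)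
    (he₁ : IsOrientationReversing (SmoothOrientation.euclidean 4) oP e₁)
    (he₂ : IsOrientationPreserving (SmoothOrientation.euclidean 4) oP e₂)
    (U : TopologicalSpace.Opens P) (hU₁ : ∀ v, e₁ v ∈ U) (hU₂ : ∀ v, e₂ v ∈ U) (hUF : ∀ p, F p ∈ U)
    (hU : IsZero (singularHomologyZ (↥U) 2)) :
    IsTowerConcordant (-o) K₁ K₂ := by
  refine h.isTowerConcordant (IsProjectiveTower.neg o t P oP hT) he₁ ?_ U hU₁ hU₂ hUF hU
  rw [isOrientationReversing_iff, neg_neg]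
  exact he₂

/-- **The `∃ o` statement does not depend on which puncture is called incoming.**  "For some `o`, `s` is antitone under
tower-concordance over `o`" (first ball preserving, second reversing — `RasmussenAntitoneOver`) is EQUIVALENT to the
same statement with the orientation characters of the two balls exchanged (first reversing, second preserving): the two
readings are exchanged by `o ↦ -o` (`isTowerConcordant_neg_of_swapped`).  Together with the chirality remark in
`ProjectiveTowersProofs.lean` this is why an `∃ o` rendering of MMSW Thm. 6.11 (cylinder case) is independent of every
chart convention of the tree. [cite: ManolescuMarengonSarkarWillis2023, §6 and Remark 6.6] -/
theorem exists_rasmussenAntitoneOver_iff_swapped :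
    (∃ o : SmoothOrientation (𝓡 4) ComplexProjectivePlane, RasmussenAntitoneOver o) ↔
      ∃ o : SmoothOrientation (𝓡 4) ComplexProjectivePlane, ∀ (K₁ K₂ : Knot),
        (∃ (t : ℕ) (P : Type) (_ : TopologicalSpace P) (_ : T2Space P) (_ : SecondCountableTopology P)
          (_ : ChartedSpace (EuclideanSpace ℝ (Fin 4)) P) (_ : IsManifold (𝓡 4) ∞ P) (_ : CompactSpace P)
          (oP : SmoothOrientation (𝓡 4) P) (e₁ e₂ : EuclideanSpace ℝ (Fin 4) → P) (F : (𝕊 1) × ℝ → P),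
          IsProjectiveTower o t P oP ∧ IsConcordanceIn K₁ K₂ P e₁ e₂ F ∧
            IsOrientationReversing (SmoothOrientation.euclidean 4) oP e₁ ∧
            IsOrientationPreserving (SmoothOrientation.euclidean 4) oP e₂ ∧
            ∃ U : TopologicalSpace.Opens P, (∀ v, e₁ v ∈ U) ∧ (∀ v, e₂ v ∈ U) ∧ (∀ p, F p ∈ U) ∧
              IsZero (singularHomologyZ (↥U) 2)) →
        ∀ s₁ s₂ : ℤ, K₁.HasRasmussenInvariant s₁ → K₂.HasRasmussenInvariant s₂ → s₂ ≤ s₁ := by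
  constructor
  · rintro ⟨o, ho⟩
    refine ⟨-o, fun K₁ K₂ hK s₁ s₂ hs₁ hs₂ => ?_⟩
    obtain ⟨t, P, _, _, _, _, _, _, oP, e₁, e₂, F, hT, hc, he₁, he₂, U, hU₁, hU₂, hUF, hU⟩ := hK
    have h' : IsTowerConcordant (- -o) K₁ K₂ := isTowerConcordant_neg_of_swapped hT hc he₁ he₂ U hU₁ hU₂ hUF hU
    rw [neg_neg] at h'
    exact ho K₁ K₂ h' s₁ s₂ hs₁ hs₂
  · rintro ⟨o, ho⟩
    refine ⟨-o, fun K₁ K₂ hK s₁ s₂ hs₁ hs₂ => ?_⟩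
    obtain ⟨t, P, _, _, _, _, _, _, oP, e₁, e₂, F, hT, hc, he₁, he₂, U, hU₁, hU₂, hUF, hU⟩ := hK
    have hT' : IsProjectiveTower o t P (-oP) := by simpa using IsProjectiveTower.neg (-o) t P oP hT
    have he₁' : IsOrientationReversing (SmoothOrientation.euclidean 4) (-oP) e₁ :=
      (isOrientationReversing_iff _ _ _).2 (by rw [neg_neg]; exact he₁)
    have he₂' : IsOrientationPreserving (SmoothOrientation.euclidean 4) (-oP) e₂ :=
      (isOrientationReversing_iff _ _ _).1 he₂
    exact ho K₁ K₂ ⟨t, P, _, ‹_›, ‹_›, _, ‹_›, ‹_›, -oP, e₁, e₂, F, hT', hc, he₁', he₂', U, hU₁, hU₂, hUF, hU⟩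
      s₁ s₂ hs₁ hs₂

/-! ### Height `0`: concordances in the shell of `ℝ⁴ ⊂ S⁴` and concordance invariance of `s` -/

section HeightZero

attribute [local instance] Knot.fact_finrank_euclideanSpace_four_add_one

/-- The **antipodal map** of `S⁴` as a diffeomorphism (a smooth involution, `contMDiff_neg_sphere`). [folklore] -/
def antipodeDiffeo : (𝕊 4) ≃ₘ⟮𝓡 4, 𝓡 4⟯ (𝕊 4) where
  toFun x := -x
  invFun x := -x
  left_inv x := neg_neg x
  right_inv x := neg_neg x
  contMDiff_toFun := contMDiff_neg_sphere
  contMDiff_invFun := contMDiff_neg_sphere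

/-- The antipodal diffeomorphism is negation (definitional). [folklore] -/
@[simp] theorem antipodeDiffeo_apply (x : 𝕊 4) : antipodeDiffeo x = -x := rfl

/-- The homothety `z ↦ -2 z` of `ℝ⁴` as a continuous linear automorphism. [folklore] -/
def negTwoSmul : 𝔼 4 ≃L[ℝ] 𝔼 4 :=
  ContinuousLinearEquiv.equivOfInverse ((-2 : ℝ) • ContinuousLinearMap.id ℝ (𝔼 4))
    ((-2 : ℝ)⁻¹ • ContinuousLinearMap.id ℝ (𝔼 4)) (fun z => by simp [smul_smul]) (fun z => by simp [smul_smul])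

/-- `negTwoSmul z = -2 • z` (definitional). [folklore] -/
@[simp] theorem negTwoSmul_apply (z : 𝔼 4) : negTwoSmul z = (-2 : ℝ) • z := rfl

/-- **The outer ball of the shell.**  For a point `a ∈ S⁴` with stereographic chart `c = chartAt a` (projection from
`-a`, `c⁻¹ : ℝ⁴ → S⁴ ∖ {-a}` the round unit-ball chart, `c⁻¹ 0 = a`), the map `z ↦ -c⁻¹(-2 • z)` is the ball chart of `S⁴`
centred at the antipode `-a` whose closed unit ball is `{-a} ∪ c⁻¹{‖y‖ ≥ 2}`: off the origin it is `c⁻¹(2 z / ‖z‖²)`,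
the chart inverse composed with the INVERSION of `ℝ⁴` in the sphere of radius `√2` (tree identity
`neg_stereographic'_symm_neg_four_smul`).  Together with `c⁻¹` it presents `S⁴ ∖ (B̊_in ⊔ B̊_out)` as the shell
`1 ≤ ‖y‖ ≤ 2` of `ℝ⁴`, i.e. as `I × S³`. [folklore] -/
def outerBall (a : 𝕊 4) (z : 𝔼 4) : 𝕊 4 :=
  -(chartAt (𝔼 4) a).symm ((-2 : ℝ) • z)

/-- The outer ball in terms of Mathlib's `stereographic'` (the chart at `a` projects from `-a`). [folklore] -/
theorem outerBall_eq_stereographic (a : 𝕊 4) (z : 𝔼 4) :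
    outerBall a z = -(stereographic' 4 (-a)).symm ((-2 : ℝ) • z) := rfl

/-- Off the origin the outer ball is the round ball after inversion: `-c⁻¹(-2 z) = c⁻¹(2 z / ‖z‖²)`. [folklore] -/
theorem outerBall_eq_of_ne_zero (a : 𝕊 4) {z : 𝔼 4} (hz : z ≠ 0) :
    outerBall a z = (chartAt (𝔼 4) a).symm ((2 * (‖z‖ ^ 2)⁻¹) • z) := by
  have hz' : (2 : ℝ)⁻¹ • z ≠ 0 := smul_ne_zero (by norm_num) hz
  have key := neg_stereographic'_symm_neg_four_smul (-a) hz'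
  rw [smul_smul, show (-4 : ℝ) * 2⁻¹ = -2 by norm_num] at key
  rw [outerBall_eq_stereographic, key, norm_smul, smul_smul]
  congr 2
  rw [Real.norm_eq_abs, abs_of_pos (by norm_num : (0 : ℝ) < 2⁻¹)]
  field_simp

/-- The centre of the outer ball is the antipode `-a`. [folklore] -/
theorem outerBall_zero (a : 𝕊 4) : outerBall a 0 = -a := by
  rw [outerBall_eq_stereographic, smul_zero, stereographic'_symm_zero, neg_neg]

/-- On the unit sphere the outer ball is `c⁻¹(2 z)`: its boundary sphere is the sphere of radius `2` of the chart.
[folklore] -/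
theorem outerBall_of_norm_eq_one (a : 𝕊 4) {z : 𝔼 4} (hz : ‖z‖ = 1) :
    outerBall a z = (chartAt (𝔼 4) a).symm ((2 : ℝ) • z) := by
  rw [outerBall_eq_of_ne_zero a (by rintro rfl; simp at hz), hz]
  norm_num

/-- The outer ball is a smooth embedding of `ℝ⁴` (antipode ∘ chart inverse ∘ homothety). [folklore] -/
theorem isSmoothEmbedding_outerBall (a : 𝕊 4) : Manifold.IsSmoothEmbedding (𝓡 4) (𝓡 4) ∞ (outerBall a) := by
  have h : outerBall a = (antipodeDiffeo ∘ (stereographic' 4 (-a)).symm) ∘ negTwoSmul.toDiffeomorph := rfl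
  rw [h]
  exact ((isSmoothEmbedding_stereographic'_symm (-a)).diffeomorph_comp antipodeDiffeo).comp_diffeomorph _

/-- A point of the closed unit ball of the outer chart is the antipode or a point `c⁻¹(y)` with `‖y‖ ≥ 2`. [folklore] -/
theorem outerBall_mem_image_closedBall (a : 𝕊 4) {p : 𝕊 4}
    (hp : p ∈ outerBall a '' Metric.closedBall (0 : 𝔼 4) 1) :
    p = -a ∨ ∃ y : 𝔼 4, 2 ≤ ‖y‖ ∧ p = (chartAt (𝔼 4) a).symm y := by
  obtain ⟨z, hz, rfl⟩ := hp
  rw [mem_closedBall_zero_iff] at hz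
  by_cases h0 : z = 0
  · left
    rw [h0, outerBall_zero]
  · right
    refine ⟨(2 * (‖z‖ ^ 2)⁻¹) • z, ?_, outerBall_eq_of_ne_zero a h0⟩
    have hpos : 0 < ‖z‖ := norm_pos_iff.2 h0
    rw [norm_smul, Real.norm_eq_abs, abs_of_pos (by positivity)]
    rw [show 2 * (‖z‖ ^ 2)⁻¹ * ‖z‖ = 2 * ‖z‖⁻¹ by field_simp]
    have : 1 ≤ ‖z‖⁻¹ := one_le_inv_iff₀.2 ⟨hpos, hz⟩
    linarith

/-- **A concordance in the shell is a concordance datum in `S⁴`.**  If `f` is a concordance from `K` to `K'`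
(`Knot.IsConcordance`: a proper annulus in the shell `1 ≤ ‖y‖ ≤ 2` of `ℝ⁴` from `K` to `2 • K'`), then `c⁻¹ ∘ f` is a
concordance datum in `S⁴` from `K` on the boundary of the round ball `c⁻¹` to `K'` on the boundary of the outer ball
`outerBall a` (`Knot.IsConcordanceIn`). [cite: FoxMilnor1966, §1] [cite: ManolescuMarengonSarkarWillis2023, Thm. 6.11 (t = 0)] -/
theorem IsConcordance.isConcordanceIn_sphere (a : 𝕊 4) {K K' : Knot} {f : (𝕊 1) × ℝ → 𝔼 4}
    (h : IsConcordance K K' f) :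
    IsConcordanceIn K K' (𝕊 4) (chartAt (𝔼 4) a).symm (outerBall a) ((chartAt (𝔼 4) a).symm ∘ f) := by
  obtain ⟨hf, hinj, himm, hshell, -, h1, h2⟩ := h
  have hc : chartAt (𝔼 4) a = stereographic' 4 (-a) := rfl
  have hσinj : Function.Injective (chartAt (𝔼 4) a).symm := stereographic'_symm_injective (-a)
  refine ⟨isSmoothEmbedding_stereographic'_symm (-a), isSmoothEmbedding_outerBall a, ?_,
    (contMDiff_stereographic'_symm (-a)).comp hf, hσinj.comp_injOn hinj, ?_, ?_, ?_, ?_⟩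
  · -- the two closed balls are disjoint
    refine disjoint_left.2 ?_
    rintro _ ⟨y, hy, rfl⟩ hp
    rw [mem_closedBall_zero_iff] at hy
    rcases outerBall_mem_image_closedBall a hp with h | ⟨y', hy', hyy'⟩
    · exact stereographic'_symm_ne (-a) y h
    · have : y = y' := hσinj hyy'
      subst this
      linarith
  · -- immersion
    intro p hp
    have hn0 : (∞ : ℕ∞ω) ≠ 0 := by simp
    have hfd : MDifferentiableAt ((𝓡 1).prod 𝓘(ℝ, ℝ)) (𝓡 4) f p := (hf p).mdifferentiableAt hn0
    have hσd : MDifferentiableAt (𝓡 4) (𝓡 4) (chartAt (𝔼 4) a).symm (f p) :=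
      (contMDiff_stereographic'_symm (-a) (f p)).mdifferentiableAt hn0
    rw [mfderiv_comp p hσd hfd]
    exact (injective_mfderiv_stereographic'_symm (-a) (f p)).comp (himm p hp)
  · -- the open annulus misses both closed balls
    intro x t ht hmem
    obtain ⟨hlo, hhi⟩ := hshell x t ht
    rcases hmem with ⟨y, hy, hyf⟩ | hmem
    · rw [mem_closedBall_zero_iff] at hy
      have : y = f (x, t) := hσinj hyf
      subst this
      linarith
    · rcases outerBall_mem_image_closedBall a hmem with h | ⟨y', hy', hyy'⟩
      · exact stereographic'_symm_ne (-a) _ h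
      · have : f (x, t) = y' := hσinj hyy'
        rw [this] at hhi
        linarith
  · intro x
    change (chartAt (𝔼 4) a).symm (f (x, 1)) = _
    rw [h1 x]
  · intro x
    change (chartAt (𝔼 4) a).symm (f (x, 2)) = outerBall a (K' x)
    rw [h2 x, outerBall_of_norm_eq_one a (by simp)]

/-- The **inversion** `z ↦ 2 z / ‖z‖²` of `ℝ⁴` in the sphere of radius `√2`. [folklore] -/
def inversionTwo (z : 𝔼 4) : 𝔼 4 := (2 * (‖z‖ ^ 2)⁻¹) • z

/-- Coordinates of the reflection `ρ = reflectLastCLM 3` (definitional). [folklore] -/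
theorem reflectLastCLM_three_apply' (v : 𝔼 4) (i : Fin 4) :
    reflectLastCLM 3 v i = if i = Fin.last 3 then -v i else v i := rfl

/-- **The inversion has negative Jacobian**: at the last basis vector `e₃` its differential is `2 ρ` with `ρ` the
reflection in the last coordinate (`d(2z/‖z‖²)ₑ h = 2h − 4⟨e, h⟩e` for `‖e‖ = 1`). [folklore] -/
theorem hasFDerivAt_inversionTwo_single :
    HasFDerivAt inversionTwo ((2 : ℝ) • (reflectLastCLM 3 : 𝔼 4 →L[ℝ] 𝔼 4)) (EuclideanSpace.single (3 : Fin 4) 1) := by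
  set e : 𝔼 4 := EuclideanSpace.single (3 : Fin 4) 1 with he
  have hnorm : ‖e‖ = 1 := by simp [he]
  have hnorm2 : ‖e‖ ^ 2 = 1 := by rw [hnorm, one_pow]
  have h1 : HasFDerivAt (fun z : 𝔼 4 => ‖z‖ ^ 2) (2 • innerSL ℝ e) e := (hasStrictFDerivAt_norm_sq e).hasFDerivAt
  have hg : HasDerivAt (fun t : ℝ => 2 * t⁻¹) (-2) (‖e‖ ^ 2) := by
    rw [hnorm2]
    have h := (hasDerivAt_inv (one_ne_zero (α := ℝ))).const_mul (2 : ℝ)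
    exact h.congr_deriv (by norm_num)
  have h3 := hg.comp_hasFDerivAt e h1
  have h4 := h3.smul (hasFDerivAt_id e)
  refine h4.congr_fderiv ?_
  ext h i
  have hinner : inner ℝ e h = h 3 := by
    rw [he, EuclideanSpace.inner_single_left]
    simp
  simp only [Function.comp_apply, hnorm2, inv_one, mul_one, add_apply, smul_apply, ContinuousLinearMap.id_apply,
    ContinuousLinearMap.smulRight_apply, innerSL_apply_apply, hinner,
    id_eq, PiLp.add_apply, PiLp.smul_apply, smul_eq_mul, nsmul_eq_mul, Nat.cast_ofNat, reflectLastCLM_three_apply']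
  rw [he]
  by_cases hi : i = Fin.last 3
  · subst hi
    simp
    ring
  · have hi3 : i ≠ (3 : Fin 4) := hi
    simp [hi3]

/-- **The outer ball has the orientation character opposite to the round ball.**  If the round ball `c⁻¹` preserves
the orientations `(standard, oS)`, then `outerBall a` reverses them: off the origin `outerBall a = c⁻¹ ∘ (inversion)`, the
inversion has negative Jacobian, and a disc either preserves or reverses orientation
(`isOrientationPreserving_or_isOrientationReversing_disc`).  This is the tree form of "the two punctures of `I × S³` are
balls of opposite orientation character". [cite: HirschDT1976, §4.4] -/
theorem isOrientationReversing_outerBall (a : 𝕊 4) {oS : SmoothOrientation (𝓡 4) (𝕊 4)}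
    (hc : IsOrientationPreserving (SmoothOrientation.euclidean 4) oS (chartAt (𝔼 4) a).symm) :
    IsOrientationReversing (SmoothOrientation.euclidean 4) oS (outerBall a) := by
  have hemb := isSmoothEmbedding_outerBall a
  have hembc := isSmoothEmbedding_stereographic'_symm (n := 4) (-a)
  have hc' : chartAt (𝔼 4) a = stereographic' 4 (-a) := rfl
  rcases isOrientationPreserving_or_isOrientationReversing_disc hemb (isOpenMap_disc hemb).isOpen_range
      (euclideanOrientation 4) oS with hpres | hrev
  swap
  · exact hrev
  exfalso
  -- compare the two charts at `z₀ = e₃`, `w₀ = inversion z₀`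
  set z₀ : 𝔼 4 := EuclideanSpace.single (3 : Fin 4) 1 with hz₀
  have hz₀ne : z₀ ≠ 0 := by
    intro h
    have := congrArg (fun v : 𝔼 4 => v 3) h
    simp [hz₀] at this
  have hn0 : (∞ : ℕ∞ω) ≠ 0 := by simp
  -- `outerBall a = c⁻¹ ∘ inversionTwo` near `z₀`
  have hev : outerBall a =ᶠ[𝓝 z₀] ((chartAt (𝔼 4) a).symm ∘ inversionTwo) := by
    filter_upwards [isOpen_ne.mem_nhds hz₀ne] with z hz
    exact outerBall_eq_of_ne_zero a hz
  have hinvd : HasFDerivAt inversionTwo ((2 : ℝ) • (reflectLastCLM 3 : 𝔼 4 →L[ℝ] 𝔼 4)) z₀ :=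
    hasFDerivAt_inversionTwo_single
  have hinvmd : MDifferentiableAt 𝓘(ℝ, 𝔼 4) 𝓘(ℝ, 𝔼 4) inversionTwo z₀ := hinvd.hasMFDerivAt.mdifferentiableAt
  have hcd : MDifferentiableAt 𝓘(ℝ, 𝔼 4) (𝓡 4) (chartAt (𝔼 4) a).symm (inversionTwo z₀) :=
    (contMDiff_stereographic'_symm (-a) _).mdifferentiableAt hn0
  have hchain : mfderiv 𝓘(ℝ, 𝔼 4) (𝓡 4) (outerBall a) z₀ =
      (mfderiv 𝓘(ℝ, 𝔼 4) (𝓡 4) (chartAt (𝔼 4) a).symm (inversionTwo z₀)).comp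
        (mfderiv 𝓘(ℝ, 𝔼 4) 𝓘(ℝ, 𝔼 4) inversionTwo z₀) := by
    rw [hev.mfderiv_eq]
    exact mfderiv_comp z₀ hcd hinvmd
  -- the Jacobian of the inversion at `z₀` is `det (2 ρ) = -16`
  have hdetinv : LinearMap.det (M := 𝔼 4) (mfderiv 𝓘(ℝ, 𝔼 4) 𝓘(ℝ, 𝔼 4) inversionTwo z₀).toLinearMap = 2 ^ 4 * (-1) := by
    rw [hinvd.hasMFDerivAt.mfderiv]
    change LinearMap.det (((2 : ℝ) • (reflectLastCLM 3 : 𝔼 4 →L[ℝ] 𝔼 4) : 𝔼 4 →L[ℝ] 𝔼 4) : 𝔼 4 →ₗ[ℝ] 𝔼 4) = _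
    rw [ContinuousLinearMap.toLinearMap_smul, LinearMap.det_smul, det_reflectLastCLM, finrank_euclideanSpace_fin]
  have hdet : LinearMap.det (M := 𝔼 4) (mfderiv 𝓘(ℝ, 𝔼 4) (𝓡 4) (outerBall a) z₀).toLinearMap =
      LinearMap.det (M := 𝔼 4) (mfderiv 𝓘(ℝ, 𝔼 4) (𝓡 4) (chartAt (𝔼 4) a).symm (inversionTwo z₀)).toLinearMap *
        (2 ^ 4 * (-1)) := by
    rw [hchain, ← hdetinv]
    exact LinearMap.det_comp (M := 𝔼 4) (mfderiv 𝓘(ℝ, 𝔼 4) (𝓡 4) (chartAt (𝔼 4) a).symm (inversionTwo z₀)).toLinearMap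
      (mfderiv 𝓘(ℝ, 𝔼 4) 𝓘(ℝ, 𝔼 4) inversionTwo z₀).toLinearMap
  have hval : outerBall a z₀ = (chartAt (𝔼 4) a).symm (inversionTwo z₀) := hev.eq_of_nhds
  -- the pointwise conditions at `z₀` (outer ball) and at `inversionTwo z₀` (round ball)
  have h₁ := hc (inversionTwo z₀)
  have h₂ := hpres z₀
  rw [hval, hdet] at h₂
  simp only [SmoothOrientation.euclidean_apply, SmoothOrientation.modelSpace_apply] at h₁ h₂
  have hne := det_mfderiv_ne_zero_of_isSmoothEmbedding hembc (isOpenMap_disc hembc).isOpen_range (inversionTwo z₀)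
  set d := LinearMap.det (M := 𝔼 4)
    (mfderiv 𝓘(ℝ, 𝔼 4) (𝓡 4) (chartAt (𝔼 4) a).symm (inversionTwo z₀)).toLinearMap with hd
  have hne' : d ≠ 0 := hne
  rcases hne'.lt_or_gt with hneg | hpos
  · -- then the round ball disagrees with `oS` there, and the outer ball would have positive determinant
    have h3 : 0 < d * (2 ^ 4 * (-1)) := by nlinarith
    have h4 := h₂.2 h3
    exact absurd (h₁.1 h4) (not_lt.2 hneg.le)
  · have h4 := h₁.2 hpos
    have h5 : 0 < d * (2 ^ 4 * (-1)) := h₂.1 h4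
    nlinarith

/-- **At height `0` every concordance is a tower-concordance, over every `o`.**  A concordance `K ~ K'` in the shell
of `ℝ⁴` becomes a concordance datum in `S⁴` (`IsConcordance.isConcordanceIn_sphere`); `S⁴` is a tower of height `0`
over any `o`, carries an orientation making the round ball `c⁻¹` orientation preserving (`exists_smoothOrientation_sphere`
and the disc dichotomy), for which the outer ball is then orientation reversing (`isOrientationReversing_outerBall`),
and `U = S⁴` has `H₂ = 0`. [cite: ManolescuMarengonSarkarWillis2023, Thm. 6.11 (t = 0) and Remark 6.1]
[cite: FoxMilnor1966, §1] -/
theorem IsConcordant.isTowerConcordant (o : SmoothOrientation (𝓡 4) ComplexProjectivePlane) {K K' : Knot}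
    (h : K.IsConcordant K') : IsTowerConcordant o K K' := by
  obtain ⟨f, hf⟩ := h
  set a : 𝕊 4 := ⟨EuclideanSpace.single 0 1, by simp⟩ with ha
  have hS := hf.isConcordanceIn_sphere a
  have hemb := hS.isSmoothEmbedding_left
  obtain ⟨oS, -⟩ := exists_smoothOrientation_sphere 4
  obtain ⟨oS', hoS'⟩ : ∃ oS' : SmoothOrientation (𝓡 4) (𝕊 4),
      IsOrientationPreserving (SmoothOrientation.euclidean 4) oS' (chartAt (𝔼 4) a).symm := by
    rcases isOrientationPreserving_or_isOrientationReversing_disc hemb (isOpenMap_disc hemb).isOpen_range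
        (euclideanOrientation 4) oS with h | h
    · exact ⟨oS, h⟩
    · exact ⟨-oS, h⟩
  exact hS.isTowerConcordant (isProjectiveTower_zero_sphere o oS') hoS' (isOrientationReversing_outerBall a hoS') ⊤
    (fun _ => trivial) (fun _ => trivial) (fun _ => trivial) isZero_singularHomologyZ_two_sphere_four_top

/-- **At height `0` the relative inequality is concordance invariance of `s` (Rasmussen 2010, Thm. 1).**  If `s` is
antitone under tower-concordance over some `o` (`RasmussenAntitoneOver o`, MMSW Thm. 1.8 = Thm. 6.11 for cylinders between
knots), then concordant knots have equal Rasmussen invariants (the named fact `HasRasmussenInvariant.eq_of_isConcordant`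
of `Rasmussen.lean`): a concordance and its reverse (`IsConcordant.swap`) are tower-concordances at height `0`
(`IsConcordant.isTowerConcordant`), giving both inequalities.  The source's remark that at `t = 0`, `r = 0` the relative
inequality is Beliakova–Wehrli's / Rasmussen's. [cite: ManolescuMarengonSarkarWillis2023, Thm. 1.5 and Thm. 6.11 (t = 0)]
[cite: Rasmussen2010, Thm. 1] -/
theorem _root_.Literature.Topology.FourManifolds.HasRasmussenInvariant.eq_of_isConcordant_of_rasmussenAntitoneOver
    {o : SmoothOrientation (𝓡 4) ComplexProjectivePlane} (h : RasmussenAntitoneOver o) :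
    HasRasmussenInvariant.eq_of_isConcordant := by
  intro K K' s s' hs hs' hc
  have h1 : s' ≤ s := h K K' (IsConcordant.isTowerConcordant o hc) s s' hs hs'
  have h2 : s ≤ s' := h K' K (IsConcordant.isTowerConcordant o hc.swap) s' s hs' hs
  omega

end HeightZero

end Knot

end Literature.Topology.FourManifolds

end
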